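import Literature.Analysis.FluidPDE.NovackScalingLawsProofs
import Literature.Analysis.FluidPDE.NovackFourThirdsFourFifthsHolds
import HarnessLib

/-!
# Novack 2024, Theorem 1 (the transverse `8/15`-type line): the discharge

Topic: Analysis/FluidPDE. Sorry-free proof `Torus.novack2024_transverseLaw_holds` of the named fact
`Torus.novack2024_transverseLaw` (`Literature.Analysis.FluidPDE.NovackScalingLaws`; M. Novack,
*Scaling laws and exact results in turbulence*, Nonlinearity 37 (2024) 095002 = arXiv:2310.01375,
Thm. 1 (1.6c), Euler case `ν = 0`, `f = 0`: for `d ≥ 2` and every weak Euler solution `(u, p)` on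
`[0,T] × T^d` with `u ∈ L³ ∩ C⁰_t L²_x`, `p ∈ L^{3/2}`, `u₀ ∈ L²`, every functional `D` with the
local energy balance and every test function `ψ` supported in `(0,T) × T^d`,
`∫₀ᵀ∫ ℓ⁻¹ ⨍ δ_L u |T_T δu|²(ℓω) dω ψ → −(4(d−1)/(d(d+2))) D ψ` as `ℓ → 0⁺`).

The proof is the printed one (op. cit. §2, Step 2, last paragraph: "In order to prove (1.6c), we
use that `|T_I v|² = |T_L v|² + |T_T v|²` for any vector `v`"): the tree proves the reduction of the
line `• = T` to the lines `• = I, L` (`Torus.novack2024_transverseLaw_of_fourThirds_fourFifths`,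
`NovackScalingLawsProofs`) and discharges the lines `• = I, L`
(`Torus.novack2024_fourThirds_fourFifths_holds`, `NovackFourThirdsFourFifthsHolds`, along Novack's
own ball-average regularisation, §2 Steps 0–2). This file composes the two; no named fact is
introduced. (`NovackScalingLaws` itself cannot host the discharge: both ingredients import it.)

## References

* M. Novack, *Scaling laws and exact results in turbulence*, Nonlinearity 37 (2024) 095002 =
  arXiv:2310.01375, Thm. 1 (1.6a–c), Remark 1, §2 Step 2 (last paragraph). [Novack2024]
* G. L. Eyink, *Local 4/5-law and energy dissipation anomaly in turbulence*, Nonlinearity 16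
  (2003) 137–145, Thm. 1, Cor. 1 (`S_T(u) = −(8/15) D(u)` in `d = 3`). [Eyink2003]
-/

noncomputable section

namespace Literature.Analysis.FluidPDE.Torus

variable {d : Type*} [Fintype d]

/-- **Novack 2024, Thm. 1 (Euler case, the transverse line `• = T`), discharged.** For `d ≥ 2` and
every weak Euler solution `(u, p)` on `[0,T] × T^d` in Novack's class (`u ∈ L³ ∩ C⁰([0,T]; L²)`,
`p ∈ L^{3/2}`, `u₀ ∈ L²`), every functional `D` satisfying the local energy balance obeys the
transverse law `∫₀ᵀ∫ ℓ⁻¹ ⨍ (δu·ω) |δu − (δu·ω)ω|²(ℓω) dω ψ → −(4(d−1)/(d(d+2))) D ψ` (`ℓ → 0⁺`) for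
every test function `ψ` supported in `(0,T) × T^d` — the named fact `Torus.novack2024_transverseLaw`,
from the discharged lines `• = I, L` (`novack2024_fourThirds_fourFifths_holds`) by Pythagoras
`|T_I v|² = |T_L v|² + |T_T v|²` on the unit sphere and `−4/d + 12/(d(d+2)) = −4(d−1)/(d(d+2))`
(`novack2024_transverseLaw_of_fourThirds_fourFifths`). [cite: Novack2024, Thm. 1] -/
theorem novack2024_transverseLaw_holds : novack2024_transverseLaw (d := d) :=
  novack2024_transverseLaw_of_fourThirds_fourFifths novack2024_fourThirds_fourFifths_holds

end Literature.Analysis.FluidPDE.Torus
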